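import Literature.NumberTheory.LFunctions.ZetaLogDerivSeries
import Summits.RiemannHypothesis.RiemannHypothesis.Theorems.Splittings.EarlyAppointmentsXiLevel0Inputs

/-!
# EarlyAppointments — the route item `XiLevel0Inputs4` (stmt-RiemannHypothesis-24732) CLOSED (slot 11d; desk rh-split-ref g23)
RH-FREE.  Nothing here bears on the truth of RH; RH is not proved.

The tenure planner's re-glued route file (rev 6, `Theses/EarlyAppointments.lean` d1c9244d49ca055b) states the support item
`XiLevel0Inputs4` INLINED at the literals of record `R ≡ 135`, `B γ = ⌈2·W₁(2γ) + 1/100⌉₊`, `T₁ = T_PT = 3 000 175 332 800`: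
(order `< 2` of `Ξ`) ∧ (column budget) ∧ (half-slab budgets).  This file closes it BY NAME:
* `item_shape` — the item is DEFINITIONALLY `IsEntireOfOrderLt 2 Ξ ∧ XiColumnBudget Bstar R135 TPT ∧ XiHalfSlabBudget Bstar R135 TPT`
  in the vocabulary of slot (11c) (`Iff.rfl`);
* `riemannXiUpper_orderLtTwo` — `Ξ` is entire of order `< 2` (exponent `7/4`, from the tree's `‖ξ₁(w)‖ ≤ C·exp(‖w‖^{7/8})`,
  `Literature.NumberTheory.LFunctions.norm_xiSq_le`, and `Ξ(z) = ξ₁(−z²)`); the same argument as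
  `Cruxes/LogCombLandingLaw/Costume.lean` `isEntireOfOrderLt_two_riemannXiUpper` (crux-strategist r1), re-homed because Cruxes
  workfiles are not importable from `Theorems/`;
* `xiBudgets_at_item_literals` — slot (11c)'s `xiBudgets_hold` (C6 rh-idea-4 g17, W-07 c8) instantiated at the item's literals
  (`R γ ≤ 135` is exactly its radius hypothesis; `Tstar = 5.17·10¹¹ < T_PT`);
* ★ `xiLevel0Inputs4_holds : EarlyAppointments.XiLevel0Inputs4`.
Credit: rh-idea-4 g17 (budgets), crux-strategist r1 (order bound), tenure planner rh-tenure-earlyapp-1 (item text).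
-/

set_option linter.dupNamespace false  -- D-0017: the mandated namespace `Summit.<S>.<S>.…` repeats `RiemannHypothesis`
namespace Summit.RiemannHypothesis.RiemannHypothesis.Theorems.Splittings.EarlyAppointmentsXiLevel0Inputs4Closed

open Real Literature.NumberTheory.LFunctions Literature.Analysis.Complex
open Summit.RiemannHypothesis.RiemannHypothesis.Theses
open Summit.RiemannHypothesis.RiemannHypothesis.Theorems.Splittings.EarlyAppointmentsXiWindowCounts
open Summit.RiemannHypothesis.RiemannHypothesis.Theorems.Splittings.EarlyAppointmentsXiZetaDictionary
open Summit.RiemannHypothesis.RiemannHypothesis.Theorems.Splittings.EarlyAppointmentsXiLevel0Inputs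

/-- `Ξ(z) = ξ₁(−z²)`: `Ξ(z) = ξ(1/2 + iz) = ξ₁((iz)²)`. -/
theorem xiSq_neg_sq (z : ℂ) : xiSq (-(z ^ 2)) = riemannXiUpper z := by
  unfold riemannXiUpper
  have h : -(z ^ 2) = (Complex.I * z) ^ 2 := by
    rw [mul_pow, Complex.I_sq]; ring
  rw [h, xiSq_sq]

/-- `Ξ` is entire of order `< 2` (exponent `7/4`), from the order-`7/8` bound for `ξ₁`. -/
theorem riemannXiUpper_orderLtTwo : IsEntireOfOrderLt 2 riemannXiUpper := by
  obtain ⟨C, hC⟩ := norm_xiSq_le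
  refine ⟨?_, 7 / 4, C, by norm_num, fun z => ?_⟩
  · have h : riemannXiUpper = fun z => xiSq (-(z ^ 2)) := by
      funext z; rw [xiSq_neg_sq]
    rw [h]
    exact differentiable_xiSq.comp ((differentiable_pow 2).neg)
  · have h := hC (-(z ^ 2))
    rw [norm_neg, norm_pow] at h
    have hz : (‖z‖ ^ 2) ^ (7 / 8 : ℝ) = ‖z‖ ^ (7 / 4 : ℝ) := by
      rw [← Real.rpow_natCast, ← Real.rpow_mul (norm_nonneg z)]
      norm_num
    rw [hz] at h
    rw [← xiSq_neg_sq]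
    exact h

/-- The item's radius literal `R ≡ 135`. -/
def R135 (_γ : ℝ) : ℝ := 135

/-- The item's switch-on height `T_PT = 3 000 175 332 800` (Platt–Trudgian). -/
def TPT : ℝ := 3000175332800

/-- SHAPE: the route item is, by unfolding only, `order < 2 ∧ XiColumnBudget Bstar R135 TPT ∧ XiHalfSlabBudget Bstar R135 TPT`. -/
theorem item_shape :
    EarlyAppointments.XiLevel0Inputs4 ↔
      (IsEntireOfOrderLt 2 riemannXiUpper ∧ XiColumnBudget Bstar R135 TPT ∧ XiHalfSlabBudget Bstar R135 TPT) :=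
  Iff.rfl

/-- The two budget conjuncts AT THE ITEM'S LITERALS, from slot (11c)'s `xiBudgets_hold`. -/
theorem xiBudgets_at_item_literals : XiColumnBudget Bstar R135 TPT ∧ XiHalfSlabBudget Bstar R135 TPT :=
  xiBudgets_hold (by norm_num [TPT]) (fun γ _ => by norm_num [R135])
    (fun γ hγ => xiSpacing_pos_of (lt_trans (by norm_num [Tstar, TPT]) hγ)) (fun γ _ => Nat.le_ceil _)

/-- ★ **The route item `XiLevel0Inputs4` (stmt-RiemannHypothesis-24732) holds** — RH-free. -/
theorem xiLevel0Inputs4_holds : EarlyAppointments.XiLevel0Inputs4 :=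
  item_shape.2 ⟨riemannXiUpper_orderLtTwo, xiBudgets_at_item_literals.1, xiBudgets_at_item_literals.2⟩

end Summit.RiemannHypothesis.RiemannHypothesis.Theorems.Splittings.EarlyAppointmentsXiLevel0Inputs4Closed
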